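import Summits.QuantumFields.YangMills.Theorems.BalabanUVNodesN05SubBP2DPerKappaSlotExistsGuarded
import Summits.QuantumFields.YangMills.Theorems.BalabanUVNodesN05SubBP2DK2SlotGammaPrime
import Summits.QuantumFields.YangMills.Theorems.BalabanUVNodesN05SubBP2DK2PerKappaSlotOfZd
import Summits.QuantumFields.YangMills.Theorems.BalabanUVNodesN05SubBP2DK2PerT8SrvGammaPrime
import Literature.MathematicalPhysics.QuantumFieldTheory.Balaban1983to89.Node00.CarriersB8SubBPCutP5Kappa
import Literature.MathematicalPhysics.QuantumFieldTheory.Balaban1983to89.B8Prop7GlevZd3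

/-!
# BalabanUVNodes ∕ N05 ([Balaban1985RegularSpaces] Lemma 1 p. 79 – Thm 8 p. 101, (1.3)–(1.5) p. 77, p. 77 «Ω_j ⊂ T_η»): EDITION «K2» OF P4's GUARDED κ-PERIODIC SLOT SUPPLIER — THE SLOT
# `B8LeafOfRecordSubBP₂DPerκ θ P Mκ Rκ ⟨lam.cutSubBP₅κPer P Mκ Rκ c₁ ρ₀, ax⟩` (EVERY index in print's class at the pinned `Mκ`: [B8] family, Proposition 5's, and the binders ∕ letters ∕
# sockets that feed them) FROM [4]-TYPE LETTERS AT PRINT-CLASS MEMBERS ONLY; the A-5′ term Slot8κ′ of director-ym №227 (b′-2) LITERALLY (plan YMPLAN-G87-N05-GO (R2) ∕ (R3))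

Track A of `YM-PLAN.md` (cell `pub-ymgap`, HUMAN RULING D-0062), node **N05**; seat `pub-ymgap-dag-n05-d` (g14, (R2) pen), 2026-08-28; bears on K1⁹ `stmt-QuantumFields-27364`
(`--supports … --as helper`, count-neutral).

WHAT.  p646636 `…N05SubBP2DPerKappaSlotExistsGuarded` RE-KEYED onto print's (1.3)–(1.4) class at the pinned `(Mκ, Rκ)` on BOTH sides: hypotheses = p638230's with print's literal
(1.3)–(1.4) «`Admissible134 θ.L Mκ Rκ i.k i.Ω`» as ONE extra member hypothesis of every [4]-type binder; the layer `exists_residB8_layer_guarded` (p638230 §1, BY NAME); the κ-cut ℤᵈ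
slot at the κ-cut P₅-pin from the «K2» knit (`…K2SlotGammaPrime`) and the κ-pin's `Iff.rfl` face; Theorem 8 surviving at the PRINT-CLASS periodic δ₂-members from the same letters
(`…K2PerT8SrvGammaPrime.t8P₂DK2Per_of_lettersSrc_γ'` on the periodic server p645630); the display's Proposition-7 slot at the unit-axial junk map (p646636 §1 BY NAME, restricted along
`Subtype.val`); Proposition 5's UNIQUENESS at the periodic members by dag-n05-c's pure-∀ transfer, its EXISTENCE there DISPLAYED (`p5ePer`, print's (1.108) on the torus over
print's class — the one conjunct that does not transfer from ℤᵈ; served by the guarded periodic Prop 5 of package «N05-(β′)-GT»); then the «K2» FILE 1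
`…K2PerKappaSlotOfZd.b8LeafOfRecordSubBP₂DPerκ_cutSubBP₅κPer_of_subBP₂Dκ`.
WHAT IS PROVED (two theorems; no estimate; no new definition):
* ★★★ `exists_residB8_b8LeafOfRecordSubBP₂DPerκ_cutSubBP₅κ_of_lettersSrc_γ'_guarded` — `(P Mκ Rκ : ℕ)` ⊢ `∃ lam c₁ ρ₀ ax, 0 < c₁ ∧ 1 ≤ ρ₀ ∧ B8LeafOfRecordSubBP₂DPerκ θ P Mκ Rκ ⟨lam.cutSubBP₅κPer P Mκ Rκ c₁ ρ₀, ax⟩`.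
* ★★★ `exists_residB8_slot8κ'_of_lettersSrc_γ'_guarded` — `(Mκ Rκ : ℕ) (1 ≤ Mκ)` ⊢ the Slot8κ′ λ-term's body LITERALLY:
  `∃ lam8, ∃ P c₁ ρ₀ ax, (0 < P ∧ Mκ * θ.L ∣ P) ∧ 0 < c₁ ∧ 1 ≤ ρ₀ ∧ B8LeafOfRecordSubBP₂DPerκ θ P Mκ Rκ ⟨lam8.cutSubBP₅κPer P Mκ Rκ c₁ ρ₀, ax⟩` at `P := Mκ·θ.L`.
HONEST FRAMING: composition BY NAME; 0 estimates of Bałaban's proved; letters ∕ sockets remain HYPOTHESES at the PRINT-CLASS (1.3)–(1.5) `Ω₀ = ℤᵈ` law members (N06 content, `m ≥ 1`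
OPEN) — ℤᵈ (infinite-volume) statements: under director-ym №227 (b) this row is the BANKED conditional twin of the guarded-socket package, which is the discharge road; p7 slot
junk-inhabited (census); count-neutral; **N05 NOT discharged**; K1⁹ NOT claimed; Bałaban AS PRINTED (Thm 8 SURVIVING form, GAPS G-B8-13; `T_η` as `P`-periodic data on `ℤᵈ`); one finite
𝕋⁴ programme at fixed ε; nothing continuum ∕ ℝ⁴ ∕ OS ∕ mass-gap ∕ Clay.  No `sorry`, no new definition.  Unit `pub-ymgap-dag-n05-d` (g14).
EDITIONS (docstring bytes only; statements ∕ proofs unchanged): g16 — [4] Thm 3.3 locator → p. 399; g17 — both theorem docstrings now NAME the displayed `p5ePer` next to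
«p638230's hypotheses VERBATIM» (referee dag-ref-A NIT-DOC-P5EPER, READ-42).
[cite: Balaban1985RegularSpaces, Lemma 1 – Thm 8 pp.79–101, Prop. 5 p.94, Prop. 7 (1.144)–(1.145) p.100, (1.3)–(1.5) p.77, p.77 («Ω_j ⊂ T_η»); Balaban1985BackgroundPropagators, Thm 3.1 p.397, Thm 3.3 p.399, (3.40) p.397]
-/

noncomputable section

namespace Summit.QuantumFields.YangMills.BalabanUVNodes.N05SubBP2DK2PerKappaSlotExistsGuarded

open Literature.MathematicalPhysics.QuantumFieldTheory.Balaban1983to89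
open Literature.MathematicalPhysics.QuantumFieldTheory.Balaban1983to89.Node00
open Literature.MathematicalPhysics.QuantumFieldTheory.Balaban1983to89.B8IdxB8LawsB (IdxB8LawsB IdxB8SubB)
open Literature.MathematicalPhysics.QuantumFieldTheory.Balaban1983to89.B8LeafModelZd (ZdIdx)
open Literature.MathematicalPhysics.QuantumFieldTheory.Balaban1983to89.B8LeafModelZd3 (SockB9P3)
open Literature.MathematicalPhysics.QuantumFieldTheory.Balaban1983to89.B9SupplySockB9P3ZdGammaUnivDelta2 (SockB9P3H2)
open Literature.MathematicalPhysics.QuantumFieldTheory.Balaban1983to89.B8LeafModelZd3P (zdGF3P zdGF3HP)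
open Literature.MathematicalPhysics.QuantumFieldTheory.Balaban1983to89.B8LeafModelZd3P2 (zdGF3P₂ zdGF3HP₂)
open Literature.MathematicalPhysics.QuantumFieldTheory.Balaban1983to89.B8TowerBondsPrinted (towerBondsP)
open Literature.MathematicalPhysics.QuantumFieldTheory.Balaban1983to89.B8SockLettersRD (SockLettersRD)
open Literature.MathematicalPhysics.QuantumFieldTheory.Balaban1983to89.B8Lemma1NonAbelian (mulCfg blockPairNA)
open Literature.MathematicalPhysics.QuantumFieldTheory.Balaban1983to89.B8LanF146 (LanF146)
open Literature.MathematicalPhysics.QuantumFieldTheory.Balaban1983to89.B8Eq138LandauZd (covLap QT InR138 IsLandau146W)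
open Literature.MathematicalPhysics.QuantumFieldTheory.Balaban1983to89.B8Prop5LandauDataZd (ZdLanIdx zdLan)
open Summit.QuantumFields.YangMills.BalabanUVNodes.N05SubBP2DK2SlotGammaPrime (b8LeafOfRecordSubBP₂DK2_cutSubBP_zdLan_printCube_of_knit_lettersSrc_γ')
open MatrixLog B7Prop1Explicit B7Prop2Explicit B7Prop1Local B7Eq92Concrete
open B8Ineq130 (tlo thi)
open B8Ineq132 (InAk covDerivFwd)
open B7Eq78Linearization (zdBlocking QprimeIter)
open B8Eq119TwistedAxial (bgT Restr129 InAx)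
open B8Eq140Level (SideTouches)
open B8Eq1117Concrete (XSpace)
open B8Prop5ContractionKLevel (Bd2)
open B8LambdaSpaceKLevel (wt)
open B8Eq184Proof (gaugeExp cfgExp)
open B8Eq146AExpansion (iEta plaqCovDeriv)
open B8Eq143PlaqExpansion (pdiv)
open B7Prop4GeneralLevels (linCovIter)
open B8Eq155JBound (Jcur wsup)
open B8ScaledSupNorm (bondNorm msup Bdd)
open B9Eq340HolderZd (hquot AdmPair)
-- `Site` alone could resolve to the torus sites of `Setup.lean`; re-export the `ℤ^d` sites of `B7Prop1Explicit`.
export B7Prop1Explicit (Site)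
open Literature.MathematicalPhysics.QuantumFieldTheory.Balaban1983to89.B8Prop6PrintedZdCubPGamma (prop6Printed_zdCubP_γ_holds_record_dvd)
open B8ScaledSupNorm (msup_le bdd_of_forall)
open Literature.MathematicalPhysics.QuantumFieldTheory.Balaban1983to89.B8LanF146 (lanF146_zero_iff)
open Literature.MathematicalPhysics.QuantumFieldTheory.Balaban1983to89.B8Eq138LandauZd (inR138_zero)
open Literature.MathematicalPhysics.QuantumFieldTheory.Balaban1983to89.B8LeafKnitRSC (B8LeafRSC)
open Literature.MathematicalPhysics.QuantumFieldTheory.Balaban1983to89.B8Prop7TowerAxialRecord (toAxialTowerResid)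
open Literature.MathematicalPhysics.QuantumFieldTheory.Balaban1983to89.B8LeafModelZdHP2Per (zdGF3HP₂Per)
open Literature.MathematicalPhysics.QuantumFieldTheory.Balaban1983to89.B8Prop7GlevZd3 (one_mulCfg inAk_mono_alpha)
open B8Eq119TwistedAxial (inAx_self)
open Summit.QuantumFields.YangMills.BalabanUVNodes.N05SubBP2DSlotExistsGuarded (exists_residB8_layer_guarded)
open Summit.QuantumFields.YangMills.BalabanUVNodes.N05SubBP2DK2PerKappaSlotOfZd (b8LeafOfRecordSubBP₂DPerκ_cutSubBP₅κPer_of_subBP₂Dκ)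
open Summit.QuantumFields.YangMills.BalabanUVNodes.N05SubBP2DPerKappaSlotExistsGuarded (prop7PrintedR_famB8OfRecordSubBP₂DPer_unitAxial)
open Literature.MathematicalPhysics.QuantumFieldTheory.Balaban1983to89.B8Eq134Admissible (Admissible134)
open Summit.QuantumFields.YangMills.BalabanUVNodes.N05SubBP2DK2PerT8SrvGammaPrime (t8P₂DK2Per_of_lettersSrc_γ')


/-! ## §2. The guarded κ-periodic slot from the «P₂D» row's letters, at every period and every pinned pair -/

/-- ★★★ **EDITION «K2» — THE GUARDED κ-PERIODIC δ₂-SLOT AT THE κ-CUT P₅-PIN, FROM THE «P₂D» ROW's LETTERS AT PRINT-CLASS MEMBERS, PERIOD-GENERIC** — p638230's guarded root RE-RUN to dag-n05-w1's κ-cut periodic slot: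
hypotheses VERBATIM plus ONE displayed letter — Proposition 5's EXISTENCE at the periodic members `p5ePer` (print's (1.108) on the torus over print's class; the one
conjunct that does not transfer from ℤᵈ, see the module header) — then `(P M₁ R : ℕ)`; conclusion `∃ lam c₁ ρ₀ ax, 0 < c₁ ∧ 1 ≤ ρ₀ ∧ B8LeafOfRecordSubBP₂DPerκ θ P Mκ Rκ ⟨lam.cutSubBP₅κPer P Mκ Rκ c₁ ρ₀, ax⟩`.  Proof: the layer
(`exists_residB8_layer_guarded`), the ℤᵈ «P₂D» slot at the cut (p618522's knit, as in p638230), Theorem 8 surviving at the periodic δ₂-members from the same letters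
(`t8P₂DPer_of_lettersSrc_γ'`), the unit-axial Proposition-7 witness (§1), FILE 1's `b8LeafOfRecordSubBP₂DPerκ_of_subBP₂D` (transfer′ for Thms 2 ∕ 4, P1′'s pure-∀ transfer
for Prop. 3, K2's restriction).  Sockets ∕ letters are HYPOTHESES (N06); N05 NOT discharged.
[cite: Balaban1985RegularSpaces, Lemma 1 – Thm 8 pp.79–101, Prop. 5 (1.106)–(1.110) p.94, (1.3)–(1.5) p.77, p.77 («Ω_j ⊂ T_η»); Balaban1985BackgroundPropagators, Thm 3.1 p.397, Thm 3.3 p.399, (3.40) p.397] -/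
theorem exists_residB8_b8LeafOfRecordSubBP₂DPerκ_cutSubBP₅κ_of_lettersSrc_γ'_guarded (θ : Stage3Params) (hD : 2 ≤ θ.D) (hL5 : 5 ≤ θ.L) (Mκ Rκ : ℕ)
    -- [Balaban1985BackgroundPropagators]'s PRIMITIVE constants read by the sockets: `B₀` (3.40), the Hölder pair `(β, B₀(β₀))` and length function, [4]'s letter bounds
    {B₀ B₀β β : ℝ} {len : Site θ.D → ℝ}
    {cB9 B₀'H B₂' BG BR cL : ℝ}
    (hcB9 : 0 < cB9) (hB₀'H : 0 < B₀'H) (hB₂' : 0 ≤ B₂') (hBG : 0 ≤ BG) (hBR : 0 ≤ BR) (hcL : 0 < cL)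
    -- [4]'s letters AT THE `Ω₀ = ℤᵈ` LAW MEMBERS ONLY: existence side (laws on print's domains) and uniqueness side
    (SLet : ∀ i : ZdIdx θ.D θ.L, i.Ω 0 = Set.univ → IdxB8LawsB θ.L i → B8ConstraintBonds.DomainSeq θ.L i.Ω → (∀ l, l < i.k → ∀ z ∈ i.Λs i.k l, ((θ.L : ℤ) ^ l) • z ∈ B8ConstraintBonds.Lam θ.L i.Ω l) → Admissible134 θ.L Mκ Rκ i.k i.Ω → SockLettersRD (𝔸 := θ.𝔸) θ.L BG BR B₀'H B₂' cL i.η i.k i.Ω i.Λs)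
    (SLetUB : ∀ i : ZdIdx θ.D θ.L, i.Ω 0 = Set.univ → IdxB8LawsB θ.L i → B8ConstraintBonds.DomainSeq θ.L i.Ω → (∀ l, l < i.k → ∀ z ∈ i.Λs i.k l, ((θ.L : ℤ) ^ l) • z ∈ B8ConstraintBonds.Lam θ.L i.Ω l) → Admissible134 θ.L Mκ Rκ i.k i.Ω → ∀ α₀ : ℝ, 0 < α₀ → α₀ ≤ cL → ∀ U₀ : Site θ.D → Fin θ.D → θ.𝔸ˣ, (∀ x κ, U₀ x κ ∈ unitaryUnits θ.𝔸) →
      InAk θ.L i.k i.η α₀ i.Ω U₀ →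
      ∃ (g Δ : (Site θ.D → θ.𝔸) →ₗ[ℂ] (Site θ.D → θ.𝔸)) (q : (Site θ.D → θ.𝔸) →ₗ[ℂ] (ℕ → Site θ.D → θ.𝔸))
        (qs : (ℕ → Site θ.D → θ.𝔸) →ₗ[ℂ] (Site θ.D → θ.𝔸)) (Aw c : (ℕ → Site θ.D → θ.𝔸) →ₗ[ℂ] (ℕ → Site θ.D → θ.𝔸))
        (H' : XSpace θ.D i.k θ.𝔸 →ₗ[ℂ] (Site θ.D → θ.𝔸)),
        (∀ x : Site θ.D → θ.𝔸, (∃ C : ℝ, ∀ y, ‖x y‖ ≤ C) → g (Δ x + qs (Aw (q x))) = x) ∧ (∀ φ, qs (c (q (g (g (qs φ))))) = qs φ) ∧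
        (∀ (f : Site θ.D → θ.𝔸), ∀ x ∈ i.Ω 0, Δ f x = covLap i.η U₀ ((i.Ω 0).indicator f) x) ∧
        (∀ (μ : ℕ → Site θ.D → θ.𝔸), ∀ x ∈ i.Ω 0, qs μ x = QT θ.L i.k (i.Λs i.k) U₀ μ x) ∧
        (∀ (f : Site θ.D → θ.𝔸) (n : ℕ), n ≤ i.k → ∀ y ∈ i.Λs i.k n, q f n y = QprimeIter (zdBlocking θ.D θ.L) (bgT θ.L U₀) n f y) ∧
        (∀ (f : Site θ.D → θ.𝔸) (n : ℕ) (y : Site θ.D), ¬ (n ≤ i.k ∧ y ∈ i.Λs i.k n) → q f n y = 0) ∧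
        (∀ (X : XSpace θ.D i.k θ.𝔸) (x : Site θ.D), ‖H' X x‖ ≤ B₀'H * ‖X‖) ∧
        (∀ n, n ≤ i.k → ∀ (X : XSpace θ.D i.k θ.𝔸), ∀ p ∈ {b : Site θ.D × Fin θ.D | SideTouches (i.Ω n) b.1 b.2},
          wt θ.L i.η n * ‖covDerivFwd i.η U₀ p.2 (H' X) p.1‖ ≤ B₀'H * ‖X‖) ∧
        (∀ X : XSpace θ.D i.k θ.𝔸, Bd2 θ.L i.η i.k i.Ω (covLap i.η U₀ (H' X)) (B₂' * ‖X‖)) ∧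
        (∀ (Y : XSpace θ.D i.k θ.𝔸) (n : ℕ) (hn : n ≤ i.k) (y : Site θ.D), y ∈ i.Λs i.k n →
          QprimeIter (zdBlocking θ.D θ.L) (bgT θ.L U₀) n (H' Y) y = Y (⟨n, Nat.lt_succ_of_le hn⟩, y)) ∧
        (∀ (f : Site θ.D → θ.𝔸) (r : ℝ), 0 ≤ r → Bd2 θ.L i.η i.k i.Ω f r →
          (∀ x, ‖g f x‖ ≤ BG * r) ∧ ∀ n, n ≤ i.k → ∀ p ∈ {b : Site θ.D × Fin θ.D | SideTouches (i.Ω n) b.1 b.2},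
            wt θ.L i.η n * ‖covDerivFwd i.η U₀ p.2 (g f) p.1‖ ≤ BG * r) ∧
        (∀ (f : Site θ.D → θ.𝔸) (r : ℝ), 0 ≤ r → Bd2 θ.L i.η i.k i.Ω f r → Bd2 θ.L i.η i.k i.Ω (f - g (qs (c (q (g f))))) (BR * r)))
    -- the SOURCELESS b9 socket of Proposition 3's frame over PRINT's class, at the law members only ([4] Thm 3.3; threshold `cB9`) — for Prop. 3 AS PRINTED
    (SB9P : ∀ i : ZdIdx θ.D θ.L, i.Ω 0 = Set.univ → IdxB8LawsB θ.L i → B8ConstraintBonds.DomainSeq θ.L i.Ω → (∀ l, l < i.k → ∀ z ∈ i.Λs i.k l, ((θ.L : ℤ) ^ l) • z ∈ B8ConstraintBonds.Lam θ.L i.Ω l) →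
      Admissible134 θ.L Mκ Rκ i.k i.Ω →
      SockB9P3H2 (𝔸 := θ.𝔸) θ.L B₀ B₀β cB9 β len i.η i.k i.Ω i.Λs (fun m j => towerBondsP θ.L i.Ω (i.Λs m) j))
    -- THEOREM 8's SOCKET-SIDE constants (source threshold `cP3`, source size factor `γ₈`, remainder slacks `γ′ γ″ γβ`) and the guard `2 ≤ 5dLB₀` on [4]'s `B₀` —
    -- NO layer equation, NO auxiliary `B₈ ∕ B₈β`, NO free-constant guard: those are CHOSEN ∕ DERIVED in the proof
    {cP3 γ₈ γ' γ'' γβ : ℝ} (hcP3 : 0 < cP3) (hγ₈ : 1 ≤ γ₈) (hγ' : 0 ≤ γ') (hγ'' : 0 ≤ γ'')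
    (hB : 2 ≤ 5 * (θ.D : ℝ) * θ.L * B₀) (hB₀β : 0 < B₀β)
    -- [Balaban1985BackgroundPropagators] Thm 3.3 WITH SOURCE in Theorem 4's frame at (1.146), γ′ letter, at the law members ONLY, asked RADIUS-UNIFORMLY: for every
    -- gauge-field radius scale `r ≥ 0` SOME threshold `c59 > 0` (print needs the one radius `r = O(B₁)`; [4] Thm 3.3 gives every `r` by shrinking its threshold) — HYPOTHESIS
    (SH59src : ∀ r : ℝ, 0 ≤ r → ∃ c59 : ℝ, 0 < c59 ∧ ∀ i : ZdIdx θ.D θ.L, i.Ω 0 = Set.univ → IdxB8LawsB θ.L i → B8ConstraintBonds.DomainSeq θ.L i.Ω → (∀ l, l < i.k → ∀ z ∈ i.Λs i.k l, ((θ.L : ℤ) ^ l) • z ∈ B8ConstraintBonds.Lam θ.L i.Ω l) → Admissible134 θ.L Mκ Rκ i.k i.Ω → ∀ α₀ α₁ : ℝ, 0 < α₀ → 0 < α₁ → α₀ + α₁ ≤ c59 →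
      ∀ U₀ U' : Site θ.D → Fin θ.D → θ.𝔸ˣ, (∀ x κ, U₀ x κ ∈ unitaryUnits θ.𝔸) → (∀ x κ, U' x κ ∈ unitaryUnits θ.𝔸) →
      ∀ φ : Site θ.D → θ.𝔸, ((InR138 θ.L i.k i.η (i.Ω 0) (i.Λs i.k) U₀ φ ∧ (∀ x, IsSelfAdjoint (φ x)) ∧ (∀ x, x ∉ i.Ω 0 → φ x = 0) ∧
          Bdd θ.L i.k i.η (-(2 : ℝ)) (fun j (x : Site θ.D) => x ∈ i.Ω j) φ) ∧
        msup θ.L i.k i.η (-(2 : ℝ)) (fun j (x : Site θ.D) => x ∈ i.Ω j) φ < γ₈ * (α₀ + α₁)) →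
      InAk θ.L i.k i.η α₀ i.Ω U₀ → InAk θ.L i.k i.η α₀ i.Ω (mulCfg U' U₀) → (∀ m, m ≤ i.k → InAx θ.L m (i.Λs m) U₀ (mulCfg U' U₀)) →
      (∀ j, j ≤ i.k → ∀ (z : Site θ.D) (μ : Fin θ.D),
        ((∀ x, InBox (tlo θ.L z j) (thi θ.L z j) x → x ∈ i.Ω j) ∨ (∀ x, InBox (tlo θ.L (z + e μ) j) (thi θ.L (z + e μ) j) x → x ∈ i.Ω j)) →
        ‖(avgIter θ.L (mulCfg U' U₀) j z μ : θ.𝔸) - (avgIter θ.L U₀ j z μ : θ.𝔸)‖ ≤ α₁) →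
      (∀ b ∈ {b : Site θ.D × Fin θ.D | SideTouches (i.Ω 0) b.1 b.2}, ‖((U' b.1 b.2 : θ.𝔸ˣ) : θ.𝔸) - 1‖ ≤ α₁) →
      (∀ m, 1 ≤ m → m ≤ i.k → ∀ (u : Site θ.D → θ.𝔸ˣ) (W : Site θ.D → Fin θ.D → θ.𝔸ˣ) (A' : Site θ.D → Fin θ.D → θ.𝔸),
        (∀ x, u x ∈ unitaryUnits θ.𝔸) → mgauge U₀ u W = U' → Restr129 θ.L m (i.Λs m) U₀ u → LanF146 θ.L i.k i.η (i.Ω 0) i.Λs U₀ φ m W →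
        (∀ y τ, IsSelfAdjoint (A' y τ)) →
        (∀ j, j ≤ m → ∀ y τ, SideTouches (i.Ω j) y τ →
        W y τ = cfgExp i.η A' y τ ∧ ‖A' y τ‖ ≤ r * (α₀ + α₁) * ((θ.L : ℝ) ^ j * i.η)⁻¹) →
        (∀ y τ, (∀ j, j ≤ m → ¬ SideTouches (i.Ω j) y τ) → A' y τ = 0) →
        msup θ.L m i.η (-(1 : ℝ)) (fun j (b : Site θ.D × Fin θ.D) => SideTouches (i.Ω j) b.1 b.2) (fun b => A' b.1 b.2)
        ≤ B₀ * (bondNorm θ.L m i.η (-(3 : ℝ)) i.Ω (fun x μ => Jcur i.η U₀ A' μ x)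
        + wsup 1 (fun p : {p : ℕ × (Site θ.D × Fin θ.D) // p.1 ≤ m ∧ p.2 ∈ towerBondsP θ.L i.Ω (i.Λs m) p.1} =>
        linCovIter θ.L U₀ (iEta i.η A') p.1.1 p.1.2.1 p.1.2.2)) + γ' * B₀ * (α₀ + α₁) ∧
        msup θ.L m i.η (-(2 : ℝ)) (fun j (t : Fin θ.D × Fin θ.D × Site θ.D) => SideTouches (i.Ω j) t.2.2 t.2.1)
        (fun t => covDerivFwd i.η U₀ t.1 (fun z => A' z t.2.1) t.2.2)
        ≤ B₀ * (bondNorm θ.L m i.η (-(3 : ℝ)) i.Ω (fun x μ => Jcur i.η U₀ A' μ x)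
        + wsup 1 (fun p : {p : ℕ × (Site θ.D × Fin θ.D) // p.1 ≤ m ∧ p.2 ∈ towerBondsP θ.L i.Ω (i.Λs m) p.1} =>
        linCovIter θ.L U₀ (iEta i.η A') p.1.1 p.1.2.1 p.1.2.2)) + γ' * B₀ * (α₀ + α₁)))
    -- THE SOURCED b9 SOCKET OF PROPOSITION 3's FRAME at the `Ω₀ = ℤᵈ` law members, threshold `cP3`, `|B₁|` over print's class at the top truncation — HYPOTHESIS
    -- ([Balaban1985BackgroundPropagators] Thm 3.3 with source; = `B8Prop3SrcZd3HPGamma`'s input letter for letter)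
    (SB9srcHP : ∀ i : ZdIdx θ.D θ.L, i.Ω 0 = Set.univ → IdxB8LawsB θ.L i → B8ConstraintBonds.DomainSeq θ.L i.Ω → (∀ l, l < i.k → ∀ z ∈ i.Λs i.k l, ((θ.L : ℤ) ^ l) • z ∈ B8ConstraintBonds.Lam θ.L i.Ω l) → Admissible134 θ.L Mκ Rκ i.k i.Ω → ∀ α₀ α₁ α₂ : ℝ, 0 < α₀ → α₀ ≤ cP3 → 0 < α₁ → 0 < α₂ → α₂ ≤ cP3 →
      ∀ (U₀ W : Site θ.D → Fin θ.D → θ.𝔸ˣ), (∀ x κ, U₀ x κ ∈ unitaryUnits θ.𝔸) → (∀ x κ, W x κ ∈ unitaryUnits θ.𝔸) →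
      ∀ f : Site θ.D → θ.𝔸, InR138 θ.L i.k i.η (i.Ω 0) (i.Λs i.k) U₀ f →
      (∀ x, IsSelfAdjoint (f x)) → (∀ x, x ∉ i.Ω 0 → f x = 0) →
      Bdd θ.L i.k i.η (-(2 : ℝ)) (fun j (x : Site θ.D) => x ∈ i.Ω j) f →
      msup θ.L i.k i.η (-(2 : ℝ)) (fun j (x : Site θ.D) => x ∈ i.Ω j) f < γ₈ * (α₀ + α₁) →
      msup θ.L i.k i.η (-(3 : ℝ)) (fun j (p : Fin θ.D × Site θ.D) => p.2 ∈ i.Ω j) (fun p => covDerivFwd i.η U₀ p.1 f p.2) < γ₈ * (α₀ + α₁) →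
      InAk θ.L i.k i.η α₀ i.Ω U₀ → InAk θ.L i.k i.η α₀ i.Ω (mulCfg W U₀) → IsLandau146W θ.L i.k i.η (i.Ω 0) (i.Λs i.k) U₀ f W →
      ∀ A' : Site θ.D → Fin θ.D → θ.𝔸, (∀ y τ, IsSelfAdjoint (A' y τ)) →
      (∀ j, j ≤ i.k → ∀ (y : Site θ.D) (τ : Fin θ.D), SideTouches (i.Ω j) y τ →
        W y τ = cfgExp i.η A' y τ ∧ ‖A' y τ‖ ≤ α₂ * ((θ.L : ℝ) ^ j * i.η)⁻¹) →
      (∀ (y : Site θ.D) (τ : Fin θ.D), (∀ j, j ≤ i.k → ¬ SideTouches (i.Ω j) y τ) → A' y τ = 0) →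
      msup θ.L i.k i.η (-(1 : ℝ)) (fun j (b : Site θ.D × Fin θ.D) => SideTouches (i.Ω j) b.1 b.2) (fun b => A' b.1 b.2)
          ≤ B₀ * (bondNorm θ.L i.k i.η (-(3 : ℝ)) i.Ω (fun x μ => Jcur i.η U₀ A' μ x)
            + wsup 1 (fun p : {p : ℕ × (Site θ.D × Fin θ.D) // p.1 ≤ i.k ∧ p.2 ∈ towerBondsP θ.L i.Ω (i.Λs i.k) p.1} =>
                linCovIter θ.L U₀ (iEta i.η A') p.1.1 p.1.2.1 p.1.2.2)) + γ'' * B₀ * (α₀ + α₁) ∧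
        msup θ.L i.k i.η (-(2 : ℝ)) (fun j (t : Fin θ.D × Fin θ.D × Site θ.D) => SideTouches (i.Ω j) t.2.2 t.2.1)
            (fun t => covDerivFwd i.η U₀ t.1 (fun z => A' z t.2.1) t.2.2)
          ≤ B₀ * (bondNorm θ.L i.k i.η (-(3 : ℝ)) i.Ω (fun x μ => Jcur i.η U₀ A' μ x)
            + wsup 1 (fun p : {p : ℕ × (Site θ.D × Fin θ.D) // p.1 ≤ i.k ∧ p.2 ∈ towerBondsP θ.L i.Ω (i.Λs i.k) p.1} =>
                linCovIter θ.L U₀ (iEta i.η A') p.1.1 p.1.2.1 p.1.2.2)) + γ'' * B₀ * (α₀ + α₁) ∧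
        bondNorm θ.L i.k i.η (-(3 : ℝ)) i.Ω (fun x μ => pdiv i.η U₀ (plaqCovDeriv i.η U₀ A') μ x)
          ≤ B₀ * (bondNorm θ.L i.k i.η (-(3 : ℝ)) i.Ω (fun x μ => Jcur i.η U₀ A' μ x)
            + wsup 1 (fun p : {p : ℕ × (Site θ.D × Fin θ.D) // p.1 ≤ i.k ∧ p.2 ∈ towerBondsP θ.L i.Ω (i.Λs i.k) p.1} =>
                linCovIter θ.L U₀ (iEta i.η A') p.1.1 p.1.2.1 p.1.2.2)) + γ'' * B₀ * (α₀ + α₁) ∧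
        bondNorm θ.L i.k i.η (-(3 : ℝ)) i.Ω (fun x μ => covLap i.η U₀ (fun z => A' z μ) x)
          ≤ B₀ * (bondNorm θ.L i.k i.η (-(3 : ℝ)) i.Ω (fun x μ => Jcur i.η U₀ A' μ x)
            + wsup 1 (fun p : {p : ℕ × (Site θ.D × Fin θ.D) // p.1 ≤ i.k ∧ p.2 ∈ towerBondsP θ.L i.Ω (i.Λs i.k) p.1} =>
                linCovIter θ.L U₀ (iEta i.η A') p.1.1 p.1.2.1 p.1.2.2)) + γ'' * B₀ * (α₀ + α₁) ∧
        msup θ.L i.k i.η (-(2 + β)) (fun j (q : Fin θ.D × Fin θ.D × (Site θ.D × Site θ.D)) => q.2.2 ∈ AdmPair i.η len ∧ q.2.2.1 ∈ i.Ω j ∧ q.2.2.2 ∈ i.Ω j)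
            (fun q => hquot i.η β len U₀ (covDerivFwd i.η U₀ q.1 (fun z => A' z q.2.1)) q.2.2)
          ≤ B₀β * (bondNorm θ.L i.k i.η (-(3 : ℝ)) i.Ω (fun x μ => Jcur i.η U₀ A' μ x)
            + wsup 1 (fun p : {p : ℕ × (Site θ.D × Fin θ.D) // p.1 ≤ i.k ∧ p.2 ∈ towerBondsP θ.L i.Ω (i.Λs i.k) p.1} =>
                linCovIter θ.L U₀ (iEta i.η A') p.1.1 p.1.2.1 p.1.2.2)) + γβ * (α₀ + α₁))
    (P : ℕ)
    -- PROPOSITION 5's EXISTENCE (1.108) AT THE PERIODIC MEMBERS OF RECORD (print's shape: torus, print class) — DISPLAYED: the one conjunct that does not transfer from ℤᵈ;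
    -- served by the guarded periodic Proposition 5 of package «N05-(β′)-GT» (director-ym №227 (b))
    (p5ePer : ∀ B₀' B₁ : ℝ, 0 < B₀' → 2 ≤ B₁ → 3 * (2 * (θ.D : ℝ) * (θ.L : ℝ) ^ 2) * BG * BR ≤ B₀' / 2 → B8.Prop5Exists B₀' B₁ (lanOfRecordSubCκPer θ P Mκ Rκ B₁)) :
    ∃ (lam : ResidB8 θ) (c₁ : ℝ) (ρ₀ : ℕ)
      (ax : ∀ j : IdxB8SubDPer θ P, (famB8OfRecordPer θ (lam.cutSubBP₅κPer P Mκ Rκ c₁ ρ₀).β (lam.cutSubBP₅κPer P Mκ Rκ c₁ ρ₀).len P j).Cfg →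
        (famB8OfRecordPer θ (lam.cutSubBP₅κPer P Mκ Rκ c₁ ρ₀).β (lam.cutSubBP₅κPer P Mκ Rκ c₁ ρ₀).len P j).Pert → (famB8OfRecordPer θ (lam.cutSubBP₅κPer P Mκ Rκ c₁ ρ₀).β (lam.cutSubBP₅κPer P Mκ Rκ c₁ ρ₀).len P j).Pert),
      0 < c₁ ∧ 1 ≤ ρ₀ ∧ B8LeafOfRecordSubBP₂DPerκ θ P Mκ Rκ ⟨lam.cutSubBP₅κPer P Mκ Rκ c₁ ρ₀, ax⟩ := by
  -- the chosen constants and layer, GUARDED (p638230 §1: `1 ≤ ρ₀`, `0 < c₁⋆` kept)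
  obtain ⟨ρ₀, B₁s, c₁s, B₈, B₈β, lam, hρ₀, hc₁s, hP6, rfl, rfl, rfl, rfl, hC₂eq, hB₁', hB₁eq, hB₂eq, hB₁big, -, hB₀8, hγB, hγB'', hB8β, hfree2, hfreeS, hr0⟩ :=
    exists_residB8_layer_guarded θ hD hL5 (β := β) (len := len) (B₀β := B₀β) hBG hBR γβ hγ₈ hγ' hγ'' hB
  obtain ⟨c59, hc59, SH⟩ := SH59src _ hr0
  -- THE ℤᵈ «P₂D» SLOT at dag-n05-w1's print-class cut (p638230's body VERBATIM)
  have hzd : B8LeafOfRecordSubBP₂Dκ θ Mκ Rκ (lam.cutSubBP₅κ Mκ Rκ c₁s ρ₀) := by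
    refine (b8LeafOfRecordSubBP₂Dκ_cutSubBP₅κ_iff_cutSubBP lam c₁s ρ₀).2 ?_
    refine b8LeafOfRecordSubBP₂DK2_cutSubBP_zdLan_printCube_of_knit_lettersSrc_γ' lam Mκ Rκ hD hC₂eq hcB9 hB₀'H hB₂' hBG hBR hcL SLet SLetUB SB9P hfree2
        IdxB8LanCκ.toZdLanIdx IdxB8LanCκ.hΩ0L IdxB8LanCκ.hΩL IdxB8LanCκ.htowerL ?_ ?_ hP6 hB₁big hc59 hcP3 hγ₈ hγ' hγ'' hB hB₀β hB₀8 hγB hγB'' hB8β hB₁' hB₁eq hB₂eq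
        hfreeS
        (fun i hΩ hl hd hlt hκ α₀ α₁ hα₀ hα₁ hαc U₀ U' hU₀ hU' φ hφ hIn hIn' hAx h135 hbd m hm1 hmk u W A' hu hg hR hLan hsa hW hA0 =>
          SH i hΩ hl hd hlt hκ α₀ α₁ hα₀ hα₁ hαc U₀ U' hU₀ hU' φ hφ hIn hIn' hAx h135 hbd m hm1 hmk u W A' hu hg hR hLan hsa
            (fun j hj y τ hst => ⟨(hW j hj y τ hst).1, (hW j hj y τ hst).2.trans_eq (by ring)⟩) hA0)
        SB9srcHP
    · intro a α₀ hα₀ hαL hIn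
      exact SLet a.1.mem.1.1.1.1 a.1.mem.1.1.1.2 a.1.mem.1.1.2 a.1.mem.1.2 a.1.mem.2 a.2 α₀ hα₀ hαL a.1.U₀ a.1.hU₀ hIn a.1.mem.1.1.1.1.k a.1.mem.1.1.1.1.hk le_rfl
    · intro a α₀ hα₀ hαL hIn
      exact SLetUB a.1.mem.1.1.1.1 a.1.mem.1.1.1.2 a.1.mem.1.1.2 a.1.mem.1.2 a.1.mem.2 a.2 α₀ hα₀ hαL a.1.U₀ a.1.hU₀ hIn
  -- THEOREM 8 SURVIVING AT THE PERIODIC δ₂-MEMBERS, from the SAME letters (CLAIM-7's periodic server under this seat's periodic T8 knit)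
  have t8Per := t8P₂DK2Per_of_lettersSrc_γ' lam P Mκ Rκ hD hB₀'H hB₂' hBG hBR hcL SLet SLetUB hc59 hcP3 hγ₈ hγ' hγ'' hB hB₀β hB₀8 hγB hγB'' hB8β hB₁eq hB₂eq hfreeS
    (fun i hΩ hl hd hlt hκ α₀ α₁ hα₀ hα₁ hαc U₀ U' hU₀ hU' φ hφ hIn hIn' hAx h135 hbd m hm1 hmk u W A' hu hg hR hLan hsa hW hA0 =>
      SH i hΩ hl hd hlt hκ α₀ α₁ hα₀ hα₁ hαc U₀ U' hU₀ hU' φ hφ hIn hIn' hAx h135 hbd m hm1 hmk u W A' hu hg hR hLan hsa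
        (fun j hj y τ hst => ⟨(hW j hj y τ hst).1, (hW j hj y τ hst).2.trans_eq (by ring)⟩) hA0)
    SB9srcHP
  -- the periodic layer at the unit-axial map, FILE 1 (transfer′ + P1′ + K2) with §1's Proposition-7 witness
  refine ⟨lam, c₁s, ρ₀, fun _ U₀ _ => (U₀, ⟨1, fun _ _ => (unitaryUnits θ.𝔸).one_mem, fun _ _ => rfl⟩), hc₁s, hρ₀, ?_⟩
  -- `2 ≤ λ.B₁` for the displayed periodic Proposition 5 (as in the knit: `2 ≤ 5dLB₀ ≤ 5dLB₈ ≤ λ.B₁`)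
  have hB₈ : 0 < B₈ := lt_of_lt_of_le lam.inp.B₀_pos hB₀8
  have h5 : 0 ≤ 5 * (θ.D : ℝ) * θ.L := by positivity
  have hD1 : (1 : ℝ) ≤ 1 + 11 * (θ.D : ℝ) ^ 2 := le_add_of_nonneg_right (by positivity)
  have hB₁2 : 2 ≤ lam.B₁ := by
    rw [hB₁eq]
    calc (2 : ℝ) ≤ 5 * (θ.D : ℝ) * θ.L * lam.inp.B₀ := hB
      _ ≤ 5 * (θ.D : ℝ) * θ.L * B₈ := mul_le_mul_of_nonneg_left hB₀8 h5
      _ = 5 * (θ.D : ℝ) * θ.L * B₈ * 1 := (mul_one _).symm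
      _ ≤ 5 * (θ.D : ℝ) * θ.L * B₈ * (1 + 11 * (θ.D : ℝ) ^ 2) := mul_le_mul_of_nonneg_left hD1 (by positivity)
  exact b8LeafOfRecordSubBP₂DPerκ_cutSubBP₅κPer_of_subBP₂Dκ lam c₁s ρ₀ _ hzd t8Per
    (B8LeafKnit.prop7PrintedR_precomp (fun j : IdxB8SubDPerκ θ P Mκ Rκ => j.1) _ _ (prop7PrintedR_famB8OfRecordSubBP₂DPer_unitAxial θ _ _ P))
    (p5ePer lam.inp.B₀' lam.B₁ lam.inp.B₀'_pos hB₁2 hfree2)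

/-- ★★★ **THE Slot8κ′ λ-TERM's BODY (director-ym №227 (b′-2)), LITERALLY** (dag-n24-w1 PRE-CLAIM-4 (R1) ∕ dag-n05-w1 WORD ∕ this seat's WORD, cell bus 2026-08-28 15:0x–15:09Z): at the outer-pinned
pair `(M₁, R)` with `1 ≤ M₁`, p638230's hypotheses VERBATIM plus the displayed periodic Proposition-5 existence letter `p5ePer` (read at `P := M₁·θ.L`) ⊢ `∃ lam8, ∃ P c₁ ρ₀ ax, (0 < P ∧ Mκ * θ.L ∣ P) ∧ 0 < c₁ ∧ 1 ≤ ρ₀ ∧ B8LeafOfRecordSubBP₂DPerκ θ P Mκ Rκ ⟨lam8.cutSubBP₅κPer P Mκ Rκ c₁ ρ₀, ax⟩`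
— the period-generic theorem at `P := M₁·θ.L` (`0 < P` from `1 ≤ M₁`, `2 ≤ θ.L`).  This is `∃ lam8, Slot8κ M₁ R θ lam8` β-reduced, the supplier shape the ONE Part-37 closer
instance of A-5′ (ii) reads; the binders are still the ℤᵈ-keyed letters (outer re-index = next module).
[cite: Balaban1985RegularSpaces, Lemma 1 – Thm 8 pp.79–101, (1.3)–(1.5) p.77, p.77 («Ω_j ⊂ T_η»); Balaban1985BackgroundPropagators, Thm 3.1 p.397, Thm 3.3 p.399] -/
theorem exists_residB8_slot8κ'_of_lettersSrc_γ'_guarded (θ : Stage3Params) (hD : 2 ≤ θ.D) (hL5 : 5 ≤ θ.L) (Mκ Rκ : ℕ)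
    -- [Balaban1985BackgroundPropagators]'s PRIMITIVE constants read by the sockets: `B₀` (3.40), the Hölder pair `(β, B₀(β₀))` and length function, [4]'s letter bounds
    {B₀ B₀β β : ℝ} {len : Site θ.D → ℝ}
    {cB9 B₀'H B₂' BG BR cL : ℝ}
    (hcB9 : 0 < cB9) (hB₀'H : 0 < B₀'H) (hB₂' : 0 ≤ B₂') (hBG : 0 ≤ BG) (hBR : 0 ≤ BR) (hcL : 0 < cL)
    -- [4]'s letters AT THE `Ω₀ = ℤᵈ` LAW MEMBERS ONLY: existence side (laws on print's domains) and uniqueness side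
    (SLet : ∀ i : ZdIdx θ.D θ.L, i.Ω 0 = Set.univ → IdxB8LawsB θ.L i → B8ConstraintBonds.DomainSeq θ.L i.Ω → (∀ l, l < i.k → ∀ z ∈ i.Λs i.k l, ((θ.L : ℤ) ^ l) • z ∈ B8ConstraintBonds.Lam θ.L i.Ω l) → Admissible134 θ.L Mκ Rκ i.k i.Ω → SockLettersRD (𝔸 := θ.𝔸) θ.L BG BR B₀'H B₂' cL i.η i.k i.Ω i.Λs)
    (SLetUB : ∀ i : ZdIdx θ.D θ.L, i.Ω 0 = Set.univ → IdxB8LawsB θ.L i → B8ConstraintBonds.DomainSeq θ.L i.Ω → (∀ l, l < i.k → ∀ z ∈ i.Λs i.k l, ((θ.L : ℤ) ^ l) • z ∈ B8ConstraintBonds.Lam θ.L i.Ω l) → Admissible134 θ.L Mκ Rκ i.k i.Ω → ∀ α₀ : ℝ, 0 < α₀ → α₀ ≤ cL → ∀ U₀ : Site θ.D → Fin θ.D → θ.𝔸ˣ, (∀ x κ, U₀ x κ ∈ unitaryUnits θ.𝔸) →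
      InAk θ.L i.k i.η α₀ i.Ω U₀ →
      ∃ (g Δ : (Site θ.D → θ.𝔸) →ₗ[ℂ] (Site θ.D → θ.𝔸)) (q : (Site θ.D → θ.𝔸) →ₗ[ℂ] (ℕ → Site θ.D → θ.𝔸))
        (qs : (ℕ → Site θ.D → θ.𝔸) →ₗ[ℂ] (Site θ.D → θ.𝔸)) (Aw c : (ℕ → Site θ.D → θ.𝔸) →ₗ[ℂ] (ℕ → Site θ.D → θ.𝔸))
        (H' : XSpace θ.D i.k θ.𝔸 →ₗ[ℂ] (Site θ.D → θ.𝔸)),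
        (∀ x : Site θ.D → θ.𝔸, (∃ C : ℝ, ∀ y, ‖x y‖ ≤ C) → g (Δ x + qs (Aw (q x))) = x) ∧ (∀ φ, qs (c (q (g (g (qs φ))))) = qs φ) ∧
        (∀ (f : Site θ.D → θ.𝔸), ∀ x ∈ i.Ω 0, Δ f x = covLap i.η U₀ ((i.Ω 0).indicator f) x) ∧
        (∀ (μ : ℕ → Site θ.D → θ.𝔸), ∀ x ∈ i.Ω 0, qs μ x = QT θ.L i.k (i.Λs i.k) U₀ μ x) ∧
        (∀ (f : Site θ.D → θ.𝔸) (n : ℕ), n ≤ i.k → ∀ y ∈ i.Λs i.k n, q f n y = QprimeIter (zdBlocking θ.D θ.L) (bgT θ.L U₀) n f y) ∧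
        (∀ (f : Site θ.D → θ.𝔸) (n : ℕ) (y : Site θ.D), ¬ (n ≤ i.k ∧ y ∈ i.Λs i.k n) → q f n y = 0) ∧
        (∀ (X : XSpace θ.D i.k θ.𝔸) (x : Site θ.D), ‖H' X x‖ ≤ B₀'H * ‖X‖) ∧
        (∀ n, n ≤ i.k → ∀ (X : XSpace θ.D i.k θ.𝔸), ∀ p ∈ {b : Site θ.D × Fin θ.D | SideTouches (i.Ω n) b.1 b.2},
          wt θ.L i.η n * ‖covDerivFwd i.η U₀ p.2 (H' X) p.1‖ ≤ B₀'H * ‖X‖) ∧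
        (∀ X : XSpace θ.D i.k θ.𝔸, Bd2 θ.L i.η i.k i.Ω (covLap i.η U₀ (H' X)) (B₂' * ‖X‖)) ∧
        (∀ (Y : XSpace θ.D i.k θ.𝔸) (n : ℕ) (hn : n ≤ i.k) (y : Site θ.D), y ∈ i.Λs i.k n →
          QprimeIter (zdBlocking θ.D θ.L) (bgT θ.L U₀) n (H' Y) y = Y (⟨n, Nat.lt_succ_of_le hn⟩, y)) ∧
        (∀ (f : Site θ.D → θ.𝔸) (r : ℝ), 0 ≤ r → Bd2 θ.L i.η i.k i.Ω f r →
          (∀ x, ‖g f x‖ ≤ BG * r) ∧ ∀ n, n ≤ i.k → ∀ p ∈ {b : Site θ.D × Fin θ.D | SideTouches (i.Ω n) b.1 b.2},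
            wt θ.L i.η n * ‖covDerivFwd i.η U₀ p.2 (g f) p.1‖ ≤ BG * r) ∧
        (∀ (f : Site θ.D → θ.𝔸) (r : ℝ), 0 ≤ r → Bd2 θ.L i.η i.k i.Ω f r → Bd2 θ.L i.η i.k i.Ω (f - g (qs (c (q (g f))))) (BR * r)))
    -- the SOURCELESS b9 socket of Proposition 3's frame over PRINT's class, at the law members only ([4] Thm 3.3; threshold `cB9`) — for Prop. 3 AS PRINTED
    (SB9P : ∀ i : ZdIdx θ.D θ.L, i.Ω 0 = Set.univ → IdxB8LawsB θ.L i → B8ConstraintBonds.DomainSeq θ.L i.Ω → (∀ l, l < i.k → ∀ z ∈ i.Λs i.k l, ((θ.L : ℤ) ^ l) • z ∈ B8ConstraintBonds.Lam θ.L i.Ω l) →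
      Admissible134 θ.L Mκ Rκ i.k i.Ω →
      SockB9P3H2 (𝔸 := θ.𝔸) θ.L B₀ B₀β cB9 β len i.η i.k i.Ω i.Λs (fun m j => towerBondsP θ.L i.Ω (i.Λs m) j))
    -- THEOREM 8's SOCKET-SIDE constants (source threshold `cP3`, source size factor `γ₈`, remainder slacks `γ′ γ″ γβ`) and the guard `2 ≤ 5dLB₀` on [4]'s `B₀` —
    -- NO layer equation, NO auxiliary `B₈ ∕ B₈β`, NO free-constant guard: those are CHOSEN ∕ DERIVED in the proof
    {cP3 γ₈ γ' γ'' γβ : ℝ} (hcP3 : 0 < cP3) (hγ₈ : 1 ≤ γ₈) (hγ' : 0 ≤ γ') (hγ'' : 0 ≤ γ'')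
    (hB : 2 ≤ 5 * (θ.D : ℝ) * θ.L * B₀) (hB₀β : 0 < B₀β)
    -- [Balaban1985BackgroundPropagators] Thm 3.3 WITH SOURCE in Theorem 4's frame at (1.146), γ′ letter, at the law members ONLY, asked RADIUS-UNIFORMLY: for every
    -- gauge-field radius scale `r ≥ 0` SOME threshold `c59 > 0` (print needs the one radius `r = O(B₁)`; [4] Thm 3.3 gives every `r` by shrinking its threshold) — HYPOTHESIS
    (SH59src : ∀ r : ℝ, 0 ≤ r → ∃ c59 : ℝ, 0 < c59 ∧ ∀ i : ZdIdx θ.D θ.L, i.Ω 0 = Set.univ → IdxB8LawsB θ.L i → B8ConstraintBonds.DomainSeq θ.L i.Ω → (∀ l, l < i.k → ∀ z ∈ i.Λs i.k l, ((θ.L : ℤ) ^ l) • z ∈ B8ConstraintBonds.Lam θ.L i.Ω l) → Admissible134 θ.L Mκ Rκ i.k i.Ω → ∀ α₀ α₁ : ℝ, 0 < α₀ → 0 < α₁ → α₀ + α₁ ≤ c59 →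
      ∀ U₀ U' : Site θ.D → Fin θ.D → θ.𝔸ˣ, (∀ x κ, U₀ x κ ∈ unitaryUnits θ.𝔸) → (∀ x κ, U' x κ ∈ unitaryUnits θ.𝔸) →
      ∀ φ : Site θ.D → θ.𝔸, ((InR138 θ.L i.k i.η (i.Ω 0) (i.Λs i.k) U₀ φ ∧ (∀ x, IsSelfAdjoint (φ x)) ∧ (∀ x, x ∉ i.Ω 0 → φ x = 0) ∧
          Bdd θ.L i.k i.η (-(2 : ℝ)) (fun j (x : Site θ.D) => x ∈ i.Ω j) φ) ∧
        msup θ.L i.k i.η (-(2 : ℝ)) (fun j (x : Site θ.D) => x ∈ i.Ω j) φ < γ₈ * (α₀ + α₁)) →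
      InAk θ.L i.k i.η α₀ i.Ω U₀ → InAk θ.L i.k i.η α₀ i.Ω (mulCfg U' U₀) → (∀ m, m ≤ i.k → InAx θ.L m (i.Λs m) U₀ (mulCfg U' U₀)) →
      (∀ j, j ≤ i.k → ∀ (z : Site θ.D) (μ : Fin θ.D),
        ((∀ x, InBox (tlo θ.L z j) (thi θ.L z j) x → x ∈ i.Ω j) ∨ (∀ x, InBox (tlo θ.L (z + e μ) j) (thi θ.L (z + e μ) j) x → x ∈ i.Ω j)) →
        ‖(avgIter θ.L (mulCfg U' U₀) j z μ : θ.𝔸) - (avgIter θ.L U₀ j z μ : θ.𝔸)‖ ≤ α₁) →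
      (∀ b ∈ {b : Site θ.D × Fin θ.D | SideTouches (i.Ω 0) b.1 b.2}, ‖((U' b.1 b.2 : θ.𝔸ˣ) : θ.𝔸) - 1‖ ≤ α₁) →
      (∀ m, 1 ≤ m → m ≤ i.k → ∀ (u : Site θ.D → θ.𝔸ˣ) (W : Site θ.D → Fin θ.D → θ.𝔸ˣ) (A' : Site θ.D → Fin θ.D → θ.𝔸),
        (∀ x, u x ∈ unitaryUnits θ.𝔸) → mgauge U₀ u W = U' → Restr129 θ.L m (i.Λs m) U₀ u → LanF146 θ.L i.k i.η (i.Ω 0) i.Λs U₀ φ m W →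
        (∀ y τ, IsSelfAdjoint (A' y τ)) →
        (∀ j, j ≤ m → ∀ y τ, SideTouches (i.Ω j) y τ →
        W y τ = cfgExp i.η A' y τ ∧ ‖A' y τ‖ ≤ r * (α₀ + α₁) * ((θ.L : ℝ) ^ j * i.η)⁻¹) →
        (∀ y τ, (∀ j, j ≤ m → ¬ SideTouches (i.Ω j) y τ) → A' y τ = 0) →
        msup θ.L m i.η (-(1 : ℝ)) (fun j (b : Site θ.D × Fin θ.D) => SideTouches (i.Ω j) b.1 b.2) (fun b => A' b.1 b.2)
        ≤ B₀ * (bondNorm θ.L m i.η (-(3 : ℝ)) i.Ω (fun x μ => Jcur i.η U₀ A' μ x)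
        + wsup 1 (fun p : {p : ℕ × (Site θ.D × Fin θ.D) // p.1 ≤ m ∧ p.2 ∈ towerBondsP θ.L i.Ω (i.Λs m) p.1} =>
        linCovIter θ.L U₀ (iEta i.η A') p.1.1 p.1.2.1 p.1.2.2)) + γ' * B₀ * (α₀ + α₁) ∧
        msup θ.L m i.η (-(2 : ℝ)) (fun j (t : Fin θ.D × Fin θ.D × Site θ.D) => SideTouches (i.Ω j) t.2.2 t.2.1)
        (fun t => covDerivFwd i.η U₀ t.1 (fun z => A' z t.2.1) t.2.2)
        ≤ B₀ * (bondNorm θ.L m i.η (-(3 : ℝ)) i.Ω (fun x μ => Jcur i.η U₀ A' μ x)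
        + wsup 1 (fun p : {p : ℕ × (Site θ.D × Fin θ.D) // p.1 ≤ m ∧ p.2 ∈ towerBondsP θ.L i.Ω (i.Λs m) p.1} =>
        linCovIter θ.L U₀ (iEta i.η A') p.1.1 p.1.2.1 p.1.2.2)) + γ' * B₀ * (α₀ + α₁)))
    -- THE SOURCED b9 SOCKET OF PROPOSITION 3's FRAME at the `Ω₀ = ℤᵈ` law members, threshold `cP3`, `|B₁|` over print's class at the top truncation — HYPOTHESIS
    -- ([Balaban1985BackgroundPropagators] Thm 3.3 with source; = `B8Prop3SrcZd3HPGamma`'s input letter for letter)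
    (SB9srcHP : ∀ i : ZdIdx θ.D θ.L, i.Ω 0 = Set.univ → IdxB8LawsB θ.L i → B8ConstraintBonds.DomainSeq θ.L i.Ω → (∀ l, l < i.k → ∀ z ∈ i.Λs i.k l, ((θ.L : ℤ) ^ l) • z ∈ B8ConstraintBonds.Lam θ.L i.Ω l) → Admissible134 θ.L Mκ Rκ i.k i.Ω → ∀ α₀ α₁ α₂ : ℝ, 0 < α₀ → α₀ ≤ cP3 → 0 < α₁ → 0 < α₂ → α₂ ≤ cP3 →
      ∀ (U₀ W : Site θ.D → Fin θ.D → θ.𝔸ˣ), (∀ x κ, U₀ x κ ∈ unitaryUnits θ.𝔸) → (∀ x κ, W x κ ∈ unitaryUnits θ.𝔸) →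
      ∀ f : Site θ.D → θ.𝔸, InR138 θ.L i.k i.η (i.Ω 0) (i.Λs i.k) U₀ f →
      (∀ x, IsSelfAdjoint (f x)) → (∀ x, x ∉ i.Ω 0 → f x = 0) →
      Bdd θ.L i.k i.η (-(2 : ℝ)) (fun j (x : Site θ.D) => x ∈ i.Ω j) f →
      msup θ.L i.k i.η (-(2 : ℝ)) (fun j (x : Site θ.D) => x ∈ i.Ω j) f < γ₈ * (α₀ + α₁) →
      msup θ.L i.k i.η (-(3 : ℝ)) (fun j (p : Fin θ.D × Site θ.D) => p.2 ∈ i.Ω j) (fun p => covDerivFwd i.η U₀ p.1 f p.2) < γ₈ * (α₀ + α₁) →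
      InAk θ.L i.k i.η α₀ i.Ω U₀ → InAk θ.L i.k i.η α₀ i.Ω (mulCfg W U₀) → IsLandau146W θ.L i.k i.η (i.Ω 0) (i.Λs i.k) U₀ f W →
      ∀ A' : Site θ.D → Fin θ.D → θ.𝔸, (∀ y τ, IsSelfAdjoint (A' y τ)) →
      (∀ j, j ≤ i.k → ∀ (y : Site θ.D) (τ : Fin θ.D), SideTouches (i.Ω j) y τ →
        W y τ = cfgExp i.η A' y τ ∧ ‖A' y τ‖ ≤ α₂ * ((θ.L : ℝ) ^ j * i.η)⁻¹) →
      (∀ (y : Site θ.D) (τ : Fin θ.D), (∀ j, j ≤ i.k → ¬ SideTouches (i.Ω j) y τ) → A' y τ = 0) →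
      msup θ.L i.k i.η (-(1 : ℝ)) (fun j (b : Site θ.D × Fin θ.D) => SideTouches (i.Ω j) b.1 b.2) (fun b => A' b.1 b.2)
          ≤ B₀ * (bondNorm θ.L i.k i.η (-(3 : ℝ)) i.Ω (fun x μ => Jcur i.η U₀ A' μ x)
            + wsup 1 (fun p : {p : ℕ × (Site θ.D × Fin θ.D) // p.1 ≤ i.k ∧ p.2 ∈ towerBondsP θ.L i.Ω (i.Λs i.k) p.1} =>
                linCovIter θ.L U₀ (iEta i.η A') p.1.1 p.1.2.1 p.1.2.2)) + γ'' * B₀ * (α₀ + α₁) ∧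
        msup θ.L i.k i.η (-(2 : ℝ)) (fun j (t : Fin θ.D × Fin θ.D × Site θ.D) => SideTouches (i.Ω j) t.2.2 t.2.1)
            (fun t => covDerivFwd i.η U₀ t.1 (fun z => A' z t.2.1) t.2.2)
          ≤ B₀ * (bondNorm θ.L i.k i.η (-(3 : ℝ)) i.Ω (fun x μ => Jcur i.η U₀ A' μ x)
            + wsup 1 (fun p : {p : ℕ × (Site θ.D × Fin θ.D) // p.1 ≤ i.k ∧ p.2 ∈ towerBondsP θ.L i.Ω (i.Λs i.k) p.1} =>
                linCovIter θ.L U₀ (iEta i.η A') p.1.1 p.1.2.1 p.1.2.2)) + γ'' * B₀ * (α₀ + α₁) ∧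
        bondNorm θ.L i.k i.η (-(3 : ℝ)) i.Ω (fun x μ => pdiv i.η U₀ (plaqCovDeriv i.η U₀ A') μ x)
          ≤ B₀ * (bondNorm θ.L i.k i.η (-(3 : ℝ)) i.Ω (fun x μ => Jcur i.η U₀ A' μ x)
            + wsup 1 (fun p : {p : ℕ × (Site θ.D × Fin θ.D) // p.1 ≤ i.k ∧ p.2 ∈ towerBondsP θ.L i.Ω (i.Λs i.k) p.1} =>
                linCovIter θ.L U₀ (iEta i.η A') p.1.1 p.1.2.1 p.1.2.2)) + γ'' * B₀ * (α₀ + α₁) ∧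
        bondNorm θ.L i.k i.η (-(3 : ℝ)) i.Ω (fun x μ => covLap i.η U₀ (fun z => A' z μ) x)
          ≤ B₀ * (bondNorm θ.L i.k i.η (-(3 : ℝ)) i.Ω (fun x μ => Jcur i.η U₀ A' μ x)
            + wsup 1 (fun p : {p : ℕ × (Site θ.D × Fin θ.D) // p.1 ≤ i.k ∧ p.2 ∈ towerBondsP θ.L i.Ω (i.Λs i.k) p.1} =>
                linCovIter θ.L U₀ (iEta i.η A') p.1.1 p.1.2.1 p.1.2.2)) + γ'' * B₀ * (α₀ + α₁) ∧
        msup θ.L i.k i.η (-(2 + β)) (fun j (q : Fin θ.D × Fin θ.D × (Site θ.D × Site θ.D)) => q.2.2 ∈ AdmPair i.η len ∧ q.2.2.1 ∈ i.Ω j ∧ q.2.2.2 ∈ i.Ω j)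
            (fun q => hquot i.η β len U₀ (covDerivFwd i.η U₀ q.1 (fun z => A' z q.2.1)) q.2.2)
          ≤ B₀β * (bondNorm θ.L i.k i.η (-(3 : ℝ)) i.Ω (fun x μ => Jcur i.η U₀ A' μ x)
            + wsup 1 (fun p : {p : ℕ × (Site θ.D × Fin θ.D) // p.1 ≤ i.k ∧ p.2 ∈ towerBondsP θ.L i.Ω (i.Λs i.k) p.1} =>
                linCovIter θ.L U₀ (iEta i.η A') p.1.1 p.1.2.1 p.1.2.2)) + γβ * (α₀ + α₁))
    (hM₁ : 1 ≤ Mκ)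
    -- PROPOSITION 5's EXISTENCE (1.108) AT THE PERIODIC MEMBERS OF RECORD (print's shape: torus, print class) — DISPLAYED: the one conjunct that does not transfer from ℤᵈ;
    -- served by the guarded periodic Proposition 5 of package «N05-(β′)-GT» (director-ym №227 (b))
    (p5ePer : ∀ B₀' B₁ : ℝ, 0 < B₀' → 2 ≤ B₁ → 3 * (2 * (θ.D : ℝ) * (θ.L : ℝ) ^ 2) * BG * BR ≤ B₀' / 2 → B8.Prop5Exists B₀' B₁ (lanOfRecordSubCκPer θ (Mκ * θ.L) Mκ Rκ B₁)) :
    ∃ (lam8 : ResidB8 θ) (P : ℕ) (c₁ : ℝ) (ρ₀ : ℕ)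
      (ax : ∀ j : IdxB8SubDPer θ P, (famB8OfRecordPer θ (lam8.cutSubBP₅κPer P Mκ Rκ c₁ ρ₀).β (lam8.cutSubBP₅κPer P Mκ Rκ c₁ ρ₀).len P j).Cfg →
        (famB8OfRecordPer θ (lam8.cutSubBP₅κPer P Mκ Rκ c₁ ρ₀).β (lam8.cutSubBP₅κPer P Mκ Rκ c₁ ρ₀).len P j).Pert → (famB8OfRecordPer θ (lam8.cutSubBP₅κPer P Mκ Rκ c₁ ρ₀).β (lam8.cutSubBP₅κPer P Mκ Rκ c₁ ρ₀).len P j).Pert),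
      (0 < P ∧ Mκ * θ.L ∣ P) ∧ 0 < c₁ ∧ 1 ≤ ρ₀ ∧ B8LeafOfRecordSubBP₂DPerκ θ P Mκ Rκ ⟨lam8.cutSubBP₅κPer P Mκ Rκ c₁ ρ₀, ax⟩ := by
  obtain ⟨lam, c₁, ρ₀, ax, hc₁, hρ₀, h⟩ := exists_residB8_b8LeafOfRecordSubBP₂DPerκ_cutSubBP₅κ_of_lettersSrc_γ'_guarded θ hD hL5 Mκ Rκ hcB9 hB₀'H hB₂' hBG hBR hcL
    SLet SLetUB SB9P hcP3 hγ₈ hγ' hγ'' hB hB₀β SH59src SB9srcHP (Mκ * θ.L) p5ePer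
  have hL1 : 1 ≤ θ.L := le_trans one_le_two θ.two_le_L
  exact ⟨lam, Mκ * θ.L, c₁, ρ₀, ax, ⟨Nat.mul_pos (Nat.lt_of_lt_of_le Nat.zero_lt_one hM₁) (Nat.lt_of_lt_of_le Nat.zero_lt_one hL1), dvd_rfl⟩, hc₁, hρ₀, h⟩

end Summit.QuantumFields.YangMills.BalabanUVNodes.N05SubBP2DK2PerKappaSlotExistsGuarded

end
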